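import Summits.QuantumFields.YangMills.Theorems.UnitScaleTiltProp7CmapSymInputs
import Summits.QuantumFields.YangMills.Theorems.UnitScaleTiltProp7Chart47T3Sym
import HarnessLib

/-!
# Route `UnitScaleTilt`, crux K1 child «MinimiserStabilityRegPr» (stmt-QuantumFields-19200), stub `stub_existenceMinimalOrbit` (EX), route (α), node (AVG-SYM) —
# **CHART-47-T³-sym AT A PRINTED-REGULAR BACKGROUND, BY NAME**: ★w1-19200 g2's `Prop7SymAvgGL.chart47sym_of_inputs` (p599598) COMPOSED with this seat's
# `Prop7SymAvgRelativeBound.inputs_CmapSym` (FILE 2, p603073) — [Balaban1985Variational] Proposition 3 for the route's symmetric average holds at every background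
# `U₀` with `RegPr F n K ε₀ U₀`, `10⁷L³ε₀ ≤ 1`, for every bounded linear `H` (the (46)-slot, ★w3-20520 g2), on every radius `ε` in print's contraction window
# «9C₂B₀ε < 1» (p. 286) with `6ε ≤ R`; and that window is inhabited (`exists_chart47sym_of_regPr`).

Cell `ym3-torus`, width seat `ym-ust-20520-w4` (gen 2).  YM₃ on T³ is a ladder rung (R3), NOT the Clay problem; nothing here is a claim about the stub, the crux, d = 4 or
the mass gap.  `--supports stmt-QuantumFields-19200 --as helper`; count-neutral; def-free; composition BY NAME only (no estimate is re-proved).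

THE LETTERS (FILE 2's): `R := L^{−(K−n)}∕(10⁶L²)` (radius in the exponent `A` of `e^{A}U₀`; print's variable is `A′ = L^{K−n}A`, (44) p. 285, so `R` is the k-FREE radius
`1∕(10⁶L²)` in `A′`), `M₀ := 1200L(3∕(10⁶L²) + 18ε₀)` (the oscillation of the log-chart on the `R`-ball), `C₂ = C₃ := 40M₀∕R²`, `c₄ := R∕4`.

* ★ `chart47sym_of_regPr` — `RegPr F n K ε₀ U₀ → 10⁷L³ε₀ ≤ 1 → 0 ≤ B₀ → (∀ X, ‖HX‖ ≤ B₀‖X‖) → 9·(40M₀∕R²)·B₀·ε < 1 → 6ε ≤ R → Chart47T3sym F n K h (40M₀∕R²) ε U₀ H`.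
* ★ `exists_chart47sym_of_regPr` — same data without `ε`: `∃ ε, 0 < ε ∧ Chart47T3sym F n K h (40M₀∕R²) ε U₀ H` (the window is inhabited: `ε := min (R∕6) (1∕(9·C₂·B₀ + 1))`).

References: T. Bałaban, CMP **102** (1985) 277–309 [Balaban1985Variational] (Prop. 3 p.289, (44)–(49) p.285, (55) p.286, (72) p.289); CMP **98** (1985) 17–51
[Balaban1985Averaging] (Prop. 4 (134)–(135) p.38).
-/

noncomputable section

open scoped BigOperators Matrix.Norms.L2Operator
open NormedSpace Metric Set

namespace Summit.QuantumFields.YangMills.Theorems.Prop7SymAvgRelativeBound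

open Literature.MathematicalPhysics.QuantumFieldTheory.Balaban1983to89
open Literature.MathematicalPhysics.QuantumFieldTheory.Balaban1983to89.T3ContinuumYM3Torus
open T3PrintedRegularMinimiser (RegPr)
open T4Continuum
open Summit.QuantumFields.YangMills.Theorems.Prop7SymAvgGL (CmapSym Chart47T3sym chart47sym_of_inputs)

variable (F : T3Family) (n K : ℕ) (h : n ≤ K)
variable {F n K}

/-- ★ **CHART-47-T³-sym AT A PRINTED-REGULAR BACKGROUND.**  For a member `(F, n, K)`, `n ≤ K`, a background `U₀` with `RegPr F n K ε₀ U₀`, `10⁷L³ε₀ ≤ 1`, a linear `H`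
with `‖HX‖ ≤ B₀‖X‖` (`B₀ ≥ 0`), and a radius `ε` with «9C₂B₀ε < 1» and `6ε ≤ R` (`C₂ := 40M₀∕R²`, `R := L^{−(K−n)}∕(10⁶L²)`, `M₀ := 1200L(3∕(10⁶L²) + 18ε₀)`):
`Chart47T3sym F n K h C₂ ε U₀ H` — (49)^sym on the `ε`-ball, the range sandwich, (55).  Proof: `chart47sym_of_inputs (inputs_CmapSym …)`.
[cite: Balaban1985Variational, Prop. 3 p.289, (44)-(49) p.285, (55) p.286, (72) p.289; Balaban1985Averaging, Prop. 4 (134)-(135) p.38] -/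
theorem chart47sym_of_regPr {ε₀ : ℝ} (hε₀ : 0 < ε₀) (hε : 10 ^ 7 * (F.L : ℝ) ^ 3 * ε₀ ≤ 1)
    (U₀ : GaugeField (F.P K) 0 (Matrix.specialUnitaryGroup (Fin 2) ℂ)) (hreg : RegPr F n K ε₀ U₀)
    {B₀ : ℝ} (hB₀ : 0 ≤ B₀) {H : (PBond (F.P n) 0 → Matrix (Fin 2) (Fin 2) ℂ) →ₗ[ℂ] (PBond (F.P K) 0 → Matrix (Fin 2) (Fin 2) ℂ)}
    (hH : ∀ X, ‖H X‖ ≤ B₀ * ‖X‖) {ε : ℝ}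
    (hq : 9 * (40 * (1200 * (F.L : ℝ) * (3 * (1 / (10 ^ 6 * (F.L : ℝ) ^ 2)) + 18 * ε₀)) / (((F.L : ℝ)⁻¹) ^ (K - n) / (10 ^ 6 * (F.L : ℝ) ^ 2)) ^ 2) * B₀ * ε < 1)
    (hRε : 6 * ε ≤ ((F.L : ℝ)⁻¹) ^ (K - n) / (10 ^ 6 * (F.L : ℝ) ^ 2)) :
    Chart47T3sym F n K h
      (40 * (1200 * (F.L : ℝ) * (3 * (1 / (10 ^ 6 * (F.L : ℝ) ^ 2)) + 18 * ε₀)) / (((F.L : ℝ)⁻¹) ^ (K - n) / (10 ^ 6 * (F.L : ℝ) ^ 2)) ^ 2) ε U₀ H := by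
  have hL3 : 3 ≤ F.L := by obtain ⟨a, ha⟩ := F.hL.1; have := F.hL.2; omega
  have hL0 : (0 : ℝ) < F.L := by exact_mod_cast (show 0 < F.L by omega)
  have hC₂ : 0 ≤ 40 * (1200 * (F.L : ℝ) * (3 * (1 / (10 ^ 6 * (F.L : ℝ) ^ 2)) + 18 * ε₀)) /
      (((F.L : ℝ)⁻¹) ^ (K - n) / (10 ^ 6 * (F.L : ℝ) ^ 2)) ^ 2 := by positivity
  exact chart47sym_of_inputs (inputs_CmapSym h hε₀ hε U₀ hreg hH) hC₂ hB₀ hq (by linarith)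

/-- ★ **THE WINDOW IS INHABITED**: under the same data (no `ε`), `∃ ε > 0, Chart47T3sym F n K h C₂ ε U₀ H` — take `ε := min (R∕6) (1∕(9C₂B₀ + 1))`.
[cite: Balaban1985Variational, Prop. 3 p.289, (57)-(62) pp.286-287] -/
theorem exists_chart47sym_of_regPr {ε₀ : ℝ} (hε₀ : 0 < ε₀) (hε : 10 ^ 7 * (F.L : ℝ) ^ 3 * ε₀ ≤ 1)
    (U₀ : GaugeField (F.P K) 0 (Matrix.specialUnitaryGroup (Fin 2) ℂ)) (hreg : RegPr F n K ε₀ U₀)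
    {B₀ : ℝ} (hB₀ : 0 ≤ B₀) {H : (PBond (F.P n) 0 → Matrix (Fin 2) (Fin 2) ℂ) →ₗ[ℂ] (PBond (F.P K) 0 → Matrix (Fin 2) (Fin 2) ℂ)}
    (hH : ∀ X, ‖H X‖ ≤ B₀ * ‖X‖) :
    ∃ ε : ℝ, 0 < ε ∧ Chart47T3sym F n K h
      (40 * (1200 * (F.L : ℝ) * (3 * (1 / (10 ^ 6 * (F.L : ℝ) ^ 2)) + 18 * ε₀)) / (((F.L : ℝ)⁻¹) ^ (K - n) / (10 ^ 6 * (F.L : ℝ) ^ 2)) ^ 2) ε U₀ H := by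
  have hL3 : 3 ≤ F.L := by obtain ⟨a, ha⟩ := F.hL.1; have := F.hL.2; omega
  have hL0 : (0 : ℝ) < F.L := by exact_mod_cast (show 0 < F.L by omega)
  set C₂ : ℝ := 40 * (1200 * (F.L : ℝ) * (3 * (1 / (10 ^ 6 * (F.L : ℝ) ^ 2)) + 18 * ε₀)) /
      (((F.L : ℝ)⁻¹) ^ (K - n) / (10 ^ 6 * (F.L : ℝ) ^ 2)) ^ 2 with hC₂def
  set R : ℝ := ((F.L : ℝ)⁻¹) ^ (K - n) / (10 ^ 6 * (F.L : ℝ) ^ 2) with hRdef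
  have hC₂ : 0 ≤ C₂ := by positivity
  have hR : 0 < R := by positivity
  have h9 : 0 < 9 * C₂ * B₀ + 1 := by positivity
  refine ⟨min (R / 6) (1 / (9 * C₂ * B₀ + 1)), lt_min (by positivity) (by positivity), ?_⟩
  refine chart47sym_of_regPr h hε₀ hε U₀ hreg hB₀ hH ?_ ?_
  · have hle : min (R / 6) (1 / (9 * C₂ * B₀ + 1)) ≤ 1 / (9 * C₂ * B₀ + 1) := min_le_right _ _
    have hnn : 0 ≤ 9 * C₂ * B₀ := by positivity
    calc 9 * C₂ * B₀ * min (R / 6) (1 / (9 * C₂ * B₀ + 1)) ≤ 9 * C₂ * B₀ * (1 / (9 * C₂ * B₀ + 1)) := by gcongr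
      _ = 9 * C₂ * B₀ / (9 * C₂ * B₀ + 1) := by ring
      _ < 1 := by rw [div_lt_one h9]; linarith
  · have hle : min (R / 6) (1 / (9 * C₂ * B₀ + 1)) ≤ R / 6 := min_le_left _ _
    linarith

end Summit.QuantumFields.YangMills.Theorems.Prop7SymAvgRelativeBound

end
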